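import Summits.ResolutionOfSingularities.ResolutionOfSingularities.Theorems.LassoCutCornerTails
import Summits.ResolutionOfSingularities.ResolutionOfSingularities.Theorems.DeltaCutRun2
import HarnessLib

/-!
# ThreadCutLaw — decomp-res node «ThreadCut» (lens-5 g31, critic row 198 CLEARED +1), tree file 1/4 of the node

Content VERBATIM from the decomp-res lens-5 g31 node `HOME/decomp-res-lens-5/g31/ThreadCut.lean` (pin 856c26bf, 917
l; HOME = run/shared/lean/pub/decomp-res): NO carry — the node imports the LANDED tree only
(`…Theorems.LassoCutCornerTails`, `…Theorems.DeltaCutRun2` = lens-6 g25 «RunCut»); every declaration is new,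
namespace `…Theorems.ThreadCut`.  Farm (node, lens + critic runs): rc 0 · 0 warn · 0 sorry · axioms std.  Critic:
CRITIC-LEDGER row 198 CLEARED +1 (RE-SEAT «THREAD», window row 195: the model kind «≤2-chart corner threads» DECIDED
in kernel — thread axis / corner / cruciform laws, engine `two_letter_eventually_heavy`; exactness
`Thread.ofCruciform`; P∞'s 2^ω threads NonIso in the model; the hyp-free carve `E1TopRunPerpetual ↔
E1TopRunPerpetualNonIso ∧ E1TopRunPerpetualIso`).  Landing orders = the lens's NODE-g31.md (442a09ac) §7, endorsed
and made precise by the critic rider INBOX :1203: (A) `ThreadCutLaw` = header + §1–§4 (node imports) `--supports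
stmt-ResolutionOfSingularities-31770`, (B) `ThreadCutPinf` = §5–§6 (imports A) same flags, (C) `ThreadCutJunction` =
§7 (imports A + `DeltaCutRun2`) `--supports stmt-ResolutionOfSingularities-26971`; INDEPENDENT of the
StallVertexCompanion/Drift sequence; all VERBATIM, `--kind proof`, no `maxHeartbeats`; the `def … : Prop` kinds /
cells (`Thread.CornerTailFrom`, `Thread.TwoChartCornerTailFrom`, `Thread.Translating`, `Cruciform`,
`EventuallyNonIsolated`, `RunThreadsNonIsolated`, `WORTopRunPerpetualNonIso`, `WORTopRunPerpetualIso`,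
`E1TopRunPerpetualNonIso`, `E1TopRunPerpetualIso`) are THIS node's cells (the two §7 WOR cells and the E1 families
tagged RESIDUAL per the rider, cn26), `Thread`, `cornerStates`, `Thread.ofCruciform`, `pinfExp` / `pinfF` /
`pinfRoot` / `pinfThread` are its objects — none is a vendored fact.  No aside switch, no item.

The lens header, verbatim:

> # ThreadCut — THE THREAD CORNER LAW: lens-5's corner calculus read WITHOUT isolation, on lens-6's perpetual threads
> (decomp-res ROOT DECOMPOSITION CELL, residual mode; lens-5 «finite/base range + asymptotic regime + bridge»,
> generation 31; critic row 195 RE-SEAT «THREAD» = the junction of lens-5's forced-walk calculus with lens-6's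
> PERPETUAL kinds (`DeltaCutClasses.E1TopRunPerpetual`, inhabited by lens-6 g26's `P∞ = z³ + s·u²·w /𝔽₃`).)
>
> THE OBJECT (§1, new, lens-5 = THREAD side).  A **THREAD** `Thread q s₀` of the E-model is a `TightDefectClasses.ForcedWalk`
> WITHOUT its `isolated` field: charts `j t`, points `b t` ON the new component, EQUIMULTIPLE, states by the tree's
> `PointBlowup.step`.  Every forced walk is a thread (`ForcedWalk.toThread`); lens-6's bad threads
> (`DeltaCutClasses.BadThread`, König `runPerpetual_iff_thread`) are threads of the scheme-level run whose points are in
> general NOT isolated in the top locus — P∞'s 2^ω threads are the model example (§6).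
>
> THE LAW (§3–§4, KERNEL, hypothesis-free: every `q`, every field, no characteristic / perfectness / root hypothesis).
> Call a stage AXIAL for the chart `u_j` when its polynomial is OFF-HEAVY (`LassoCut.OffHeavy q j F`: every monomial has
> off-`j` degree `≥ q`; then `topIdeal q F ≤ (u_i : i ≠ j)` — the `u_j`-AXIS IS A TOP LINE —
`LassoCut.topIdeal_le_axis_of_offHeavy`).
> * THREAD AXIS LAW (`Thread.offHeavy_of_axis_tail`): a thread that sits from time `t₀` on at the ORIGIN of ONE chart `u_j`
>   (`j_t = j`, `b_t = 0`) is axial for `u_j` at EVERY stage of the tail — immediately, by infinite descent of light monomials.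
> * THREAD CORNER LAW (`Thread.eventually_offHeavy_of_twoChart_corner_tail`): a thread that passes from time `T₀` on
>   through CORNER points only (`b_t = 0`) and avoids one chart `u_l` is EVENTUALLY AXIAL for the played chart at every
>   step; if both remaining charts recur it is EVENTUALLY CRUCIFORM (`Thread.eventually_cruciform`: axial for BOTH, i.e. the
>   thread point is the crossing of two top lines).  ENGINE: `two_letter_eventually_heavy` = lens-5 g13's
>   `CornerTowerDescent.two_letter_descent` read WITHOUT its isolation witness — the `SL₂(ℤ)` product potential
>   `Σ π⁻ ∈ ℕ` never increases and drops at every LIGHT step, so a thread has FINITELY MANY light steps (for a forced walk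
>   isolation makes every step light: «absurd»; for a thread: «eventually axial»).
> * EXACTNESS (§5, `Thread.ofCruciform`): conversely a clean stage that is axial for two charts `J ≠ K` (all monomials of
>   degree `≥ q`) carries the WHOLE binary tree `{J,K}^ℕ` of infinite corner threads.  So the kind «≤2-chart corner
>   threads» is DECIDED iff-wise in kernel: they exist exactly over (eventually) axial / cruciform stages, and there
they branch.
> * RECOVERY (§3–§4): the tree's forced-walk cells `LassoCut.no_axis_tail`, `LassoCut.no_twoChart_corner_tail` are
>   «thread law + isolation» in one line (`ForcedWalk.no_axis_tail'`, `ForcedWalk.no_twoChart_corner_tail'`).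
>
> THE JUNCTION (§6–§7).  §6: lens-6's P∞ in lens-5's currency — root `⟨X_s·X_u²·X_w, 0⟩` (`q = 3`), axial for `s` and
> `w`, light for `u` (`pinf_cruciform`, `pinf_not_offHeavy_u`; a ROOT state, `pinf_isRoot`), hence NOT an isolated top point
> and carrying NO forced walk (`pinf_not_isolatedTop`, `pinf_no_forcedWalk`), but carrying the thread `pinfThread K ω` for EVERY
> word `ω : ℕ → Bool` (chart `s`/`w`, all `b = 0`; `pinfWord_injective`), each a two-chart corner thread
> (`pinfThread_twoChartCornerTail`) that is cruciform and non-isolated at EVERY stage (`pinfThread_cruciform_not_isolated`)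
> with residual polynomial LITERALLY `s·u²·w` again (`pinfThread_F`) — the model rendering of lens-6's `Pinf_chart_s/_w`,
> `Pinf_top` (top locus `L_s ∪ L_w`), `Pinf_perpetual_certificate` (cited BY NAME, nothing re-typed).  §7: the EXACT hyp-free
> DICHOTOMY of lens-6's perpetual kind by the scheme shadow of axiality — `EventuallyNonIsolated (T : BadThread n N)` (thread
> point non-isolated in `{ord ≥ n}` at all late levels): `WORTopRunPerpetual n ↔ WORTopRunPerpetualNonIso n ∧
WORTopRunPerpetualIso n`
> (`worTopRunPerpetual_iff_nonIso_iso`; `E 1` aggregate = `node_equation`), lens-6's binders VERBATIM.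
> P∞ inhabits the NonIso side (model certificate §6); forced towers / forced walks (lens-4 / lens-5 columns) are the
> extreme of the Iso side; by the law the Iso side contains NO ≤2-chart corner thread of the model
> (`Thread.not_twoChart_corner_of_isolated_io`).
>
> TAGS.  DECIDED IN KERNEL: the walk kind «≤2-chart corner threads» (structure + existence, iff); EMPTY IN KERNEL: «≤2-chart
> corner threads with infinitely many light (non-axial) steps» (`Thread.no_light_io_twoChart_corner_tail`).  BRIDGE (by name,
> prose): an axial stage puts the thread point on TOP LINES, i.e. inside the strict transform of the old top locus that
> lens-6's separating hop blows up second (`DeltaCutClasses.sepHop`, `oldTopCentre`, `support_oldTopCentre_subset_support`;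
> P∞: `Pinf_sepHeightOne_certificate`) — the model→scheme dictionary itself is the open TowerDictionary PORT (UNDECIDED).
> OPEN (honest): both scheme cells of §7 qua resolution statements (lens-6's column: `SepTerminates`); three-chart corner
> threads (open for forced walks too: `LassoCut.corner_tail_uses_all_charts` is all that is known); translating threads
> (`b_t ≠ 0` i.o.; = lens-5's column 31770 for forced walks).  0 `sorry`; tree-only imports.
> (Sources: Hauser2010 §§F–G; CornerTowerDescent (lens-5 g13); DeltaCutRun2 (lens-6 g25); lens-6 g26 «SepCut».)

## This file

§1–§4 THE THREAD CORNER LAW (node l. 70–550): `section Object` (§1 THE OBJECT: `Thread q s₀` = a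
`TightDefectClasses.ForcedWalk` WITHOUT its `isolated` field — charts `j t`, points `b t` on the new component,
equimultiple, states by `PointBlowup.step`; `ForcedWalk.toThread`; tails `AxisTail` / `TwoChartCornerTail`),
`section Calculus` (§2 the corner calculus of a thread read without isolation: light / heavy steps, the `SL₂(ℤ)`
product potential), `section AxisLaw` (§3 THREAD AXIS LAW `Thread.offHeavy_of_axis_tail` + recovery
`ForcedWalk.no_axis_tail'`), `section CornerLaw` (§4 THREAD CORNER LAW
`Thread.eventually_offHeavy_of_twoChart_corner_tail`, `Thread.eventually_cruciform`, ENGINE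
`two_letter_eventually_heavy` = `CornerTowerDescent.two_letter_descent` without its isolation witness,
`Thread.no_light_io_twoChart_corner_tail`, `Thread.not_twoChart_corner_of_isolated_io`, recovery
`ForcedWalk.no_twoChart_corner_tail'`) — continued in `ThreadCutLaw2` where the 400-line cap cuts.  (This first part
carries: `Thread`, `_root_.Summit.ResolutionOfSingularities.ResolutionOfSingularities.Theorems.TightDefectClasses.ForcedWalk.toThread`, `_root_.Summit.ResolutionOfSingularities.ResolutionOfSingularities.Theorems.TightDefectClasses.ForcedWalk.toThread_st`, `_root_.Summit.ResolutionOfSingularities.ResolutionOfSingularities.Theorems.TightDefectClasses.ForcedWalk.toThread_j`, `_root_.Summit.ResolutionOfSingularities.ResolutionOfSingularities.Theorems.TightDefectClasses.ForcedWalk.toThread_b`, `Thread.CornerTailFrom`, `Thread.TwoChartCornerTailFrom`, `Thread.Translating`, `Thread.translating_or_cornerTail`, `Thread.coeff_st_succ_eq_zero`, `Thread.le_degree_of_mem_support_succ`, `Thread.not_isPthPowerExponent_of_mem_support_succ`, `Thread.low_monomial_transport`, `Thread.support_succ_subset_image`, `offDegree_chartExponent_of_ne`, `Thread.offHeavy_succ`,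 `Thread.offHeavy_of_axis_tail`, `Thread.axis_tail_axial`, `_root_.Summit.ResolutionOfSingularities.ResolutionOfSingularities.Theorems.TightDefectClasses.ForcedWalk.no_axis_tail'`.)

[WRITER NOTE (decomp-res writer g12): file split only (tree files ≤ 400 lines); namespace, sections, section
variables / opens and every declaration exactly as in the lens (the node's HOME-only dupNamespace-linter line is
dropped; the namespace-level `open` lines of the node are replayed in every part).]

(Sources: Hauser2010 §§F–G (kangaroo points, corner calculus); HauserPerlega2019 §2; Hironaka1967;
CossartJannsenSaito2020 Ch. 8; CossartPiltant2008 §2; CornerTowerDescent (lens-5 g13, tree); DeltaCutRun2 (lens-6 g25, tree).)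
-/

open MvPolynomial
open Literature.AlgebraicGeometry.Resolution
open Literature.AlgebraicGeometry.Resolution.Hauser2010
open Literature.AlgebraicGeometry.Resolution.PointBlowup
open Summit.ResolutionOfSingularities.ResolutionOfSingularities.Theorems.TightDefectClasses
open Summit.ResolutionOfSingularities.ResolutionOfSingularities.Theorems.CornerTowerDescent
open Summit.ResolutionOfSingularities.ResolutionOfSingularities.Theorems.LassoCut

namespace Summit.ResolutionOfSingularities.ResolutionOfSingularities.Theorems.ThreadCut

section Object

variable {σ : Type} [DecidableEq σ] {K : Type} [Field K] [DecidableEq K]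

/-! ## §1 THE OBJECT: threads (forced walks without isolation) -/

/-- A **THREAD** of the E-model from `s₀`: charts `j t`, points `b t` ON the new exceptional component, EQUIMULTIPLE,
states `st (t+1) = step q (j t) (b t) (st t)` — a `ForcedWalk` WITHOUT the isolation of the top locus.  DEFINITION (the
node's new typed object; lens-6's `BadThread`s are its scheme-level counterpart). (Sources: Hauser2010 §§F–G.) -/
structure Thread (q : ℕ) (s₀ : State σ K) where
  /-- the chart `u_{j t}` of the `t`-th point blow-up -/
  j : ℕ → σ
  /-- the point of the `t`-th exceptional divisor blown up next -/
  b : ℕ → σ → K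
  /-- the states -/
  st : ℕ → State σ K
  /-- the thread starts at `s₀` -/
  st_zero : st 0 = s₀
  /-- each state is the tree's `step` of the previous one -/
  st_succ : ∀ t, st (t + 1) = step q (j t) (b t) (st t)
  /-- the point lies ON the new exceptional component -/
  onExc : ∀ t, b t (j t) = 0
  /-- the point is EQUIMULTIPLE -/
  equimult : ∀ t, IsEquimultiplePoint q (j t) (b t) (st t)

/-- Every forced walk is a thread (forget isolation). [folklore] -/
def _root_.Summit.ResolutionOfSingularities.ResolutionOfSingularities.Theorems.TightDefectClasses.ForcedWalk.toThread
    {q : ℕ} {s₀ : State σ K} (W : ForcedWalk q s₀) : Thread q s₀ :=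
  ⟨W.j, W.b, W.st, W.st_zero, W.st_succ, W.onExc, W.equimult⟩

/-- bookkeeping. [folklore] -/
@[simp] theorem _root_.Summit.ResolutionOfSingularities.ResolutionOfSingularities.Theorems.TightDefectClasses.ForcedWalk.toThread_st
    {q : ℕ} {s₀ : State σ K} (W : ForcedWalk q s₀) (t : ℕ) : W.toThread.st t = W.st t := rfl

/-- bookkeeping. [folklore] -/
@[simp] theorem _root_.Summit.ResolutionOfSingularities.ResolutionOfSingularities.Theorems.TightDefectClasses.ForcedWalk.toThread_j
    {q : ℕ} {s₀ : State σ K} (W : ForcedWalk q s₀) (t : ℕ) : W.toThread.j t = W.j t := rfl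

/-- bookkeeping. [folklore] -/
@[simp] theorem _root_.Summit.ResolutionOfSingularities.ResolutionOfSingularities.Theorems.TightDefectClasses.ForcedWalk.toThread_b
    {q : ℕ} {s₀ : State σ K} (W : ForcedWalk q s₀) (t : ℕ) : W.toThread.b t = W.b t := rfl

/-- A CORNER TAIL from time `T₀`: no translations. DEFINITION (thread kind). -/
def Thread.CornerTailFrom {q : ℕ} {s₀ : State σ K} (T : Thread q s₀) (T₀ : ℕ) : Prop :=
  ∀ t, T₀ ≤ t → T.b (t + 1) = 0

/-- A TWO-CHART CORNER TAIL from time `T₀` avoiding the chart `u_l`. DEFINITION (thread kind; P∞'s threads, `l = u`). -/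
def Thread.TwoChartCornerTailFrom {q : ℕ} {s₀ : State σ K} (T : Thread q s₀) (l : σ) (T₀ : ℕ) : Prop :=
  ∀ t, T₀ ≤ t → T.b (t + 1) = 0 ∧ T.j (t + 1) ≠ l

/-- A TRANSLATING thread: translations infinitely often (the complement kind; lens-5's column for forced walks).
DEFINITION (thread kind). -/
def Thread.Translating {q : ℕ} {s₀ : State σ K} (T : Thread q s₀) : Prop :=
  ∀ N, ∃ t, N ≤ t ∧ T.b (t + 1) ≠ 0

/-- DICHOTOMY of threads (excluded middle): translating, or a corner tail. [folklore] -/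
theorem Thread.translating_or_cornerTail {q : ℕ} {s₀ : State σ K} (T : Thread q s₀) :
    T.Translating ∨ ∃ T₀, T.CornerTailFrom T₀ := by
  by_cases h : T.Translating
  · exact Or.inl h
  · right
    unfold Thread.Translating at h
    push Not at h
    obtain ⟨N, hN⟩ := h
    exact ⟨N, fun t ht => hN t ht⟩

end Object

section Calculus

variable {K : Type} [Field K] [DecidableEq K] {q : ℕ} {s₀ : State (Fin 3) K}

/-! ## §2 The corner-step calculus of a thread (isolation-free transport; proofs as in `LassoCutAxisTails` for walks) -/

/-- After any step the monomials of degree `< q` are gone. (Sources: Hauser2010, §F.) -/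
theorem Thread.coeff_st_succ_eq_zero (T : Thread q s₀) (t : ℕ) {m : Fin 3 →₀ ℕ} (hm : m.degree < q) :
    coeff m (T.st (t + 1)).F = 0 := by
  classical
  rw [T.st_succ t]
  change coeff m (deletePthPowers q (pointTransform q (T.j t) (T.b t) (T.st t))) = 0
  rw [coeff_deletePthPowers]
  split_ifs with h
  · rfl
  · by_cases hm0 : m = 0
    · exfalso
      apply h
      subst hm0
      intro i hi
      simp at hi
    · exact T.equimult t m hm0 hm

/-- … so every monomial after a step has degree `≥ q`. (Sources: Hauser2010, §F.) -/
theorem Thread.le_degree_of_mem_support_succ (T : Thread q s₀) (t : ℕ) {m : Fin 3 →₀ ℕ}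
    (hm : m ∈ (T.st (t + 1)).F.support) : q ≤ m.degree := by
  by_contra h
  exact (MvPolynomial.mem_support_iff.mp hm) (T.coeff_st_succ_eq_zero t (not_le.mp h))

/-- … and none of them is a `q`-th power exponent. (Sources: Hauser2010, §F.) -/
theorem Thread.not_isPthPowerExponent_of_mem_support_succ (T : Thread q s₀) (t : ℕ) {m : Fin 3 →₀ ℕ}
    (hm : m ∈ (T.st (t + 1)).F.support) : ¬ IsPthPowerExponent q m := by
  classical
  intro hP
  rw [T.st_succ t, MvPolynomial.mem_support_iff] at hm
  apply hm
  change coeff m (deletePthPowers q (pointTransform q (T.j t) (T.b t) (T.st t))) = 0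
  rw [coeff_deletePthPowers, if_pos hP]

/-- One CORNER step transports every low monomial to a low monomial of smaller degree. (Sources: Hauser2010, §F.) -/
theorem Thread.low_monomial_transport (T : Thread q s₀) {j : Fin 3} {t : ℕ} (hj : T.j (t + 1) = j)
    (hb : T.b (t + 1) = 0) {m : Fin 3 →₀ ℕ} (hm : m ∈ (T.st (t + 1)).F.support) (hlow : m.degree - m j < q) :
    chartExponent q j m ∈ (T.st (t + 1 + 1)).F.support ∧
      (chartExponent q j m).degree - chartExponent q j m j < q ∧ (chartExponent q j m).degree < m.degree := by
  classical
  have hq : q ≤ m.degree := T.le_degree_of_mem_support_succ t hm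
  have hall : ∀ d ∈ (T.st (t + 1)).F.support, q ≤ d.degree := fun d hd => T.le_degree_of_mem_support_succ t hd
  have hnot : ¬ IsPthPowerExponent q (chartExponent q j m) :=
    not_isPthPowerExponent_chartExponent hq (T.not_isPthPowerExponent_of_mem_support_succ t hm) hlow
  refine ⟨?_, by rw [offDegree_chartExponent q j m]; exact hlow, degree_chartExponent_lt hq hlow⟩
  rw [MvPolynomial.mem_support_iff, T.st_succ (t + 1)]
  change coeff (chartExponent q j m)
    (deletePthPowers q (translate (T.b (t + 1)) (chartTransform q (T.j (t + 1)) (T.st (t + 1)).F))) ≠ 0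
  rw [hb, hj, PointBlowup.translate_zero, coeff_deletePthPowers, if_neg hnot,
    HauserPerlega2024.coeff_chartExponent_chartTransform q j hall hm]
  exact MvPolynomial.mem_support_iff.mp hm

/-- At a corner step the new support lies in the image of the old one under the chart exponent law. (Sources:
Hauser2010, §F.) -/
theorem Thread.support_succ_subset_image (T : Thread q s₀) (t : ℕ) (hb : T.b (t + 1) = 0) :
    (T.st (t + 1 + 1)).F.support ⊆ (T.st (t + 1)).F.support.image (chartExponent q (T.j (t + 1))) := by
  classical
  intro m hm
  have hall : ∀ d ∈ (T.st (t + 1)).F.support, q ≤ d.degree := fun d hd => T.le_degree_of_mem_support_succ t hd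
  rw [MvPolynomial.mem_support_iff, T.st_succ (t + 1)] at hm
  change coeff m (deletePthPowers q (translate (T.b (t + 1)) (chartTransform q (T.j (t + 1)) (T.st (t + 1)).F))) ≠ 0
    at hm
  rw [hb, PointBlowup.translate_zero, coeff_deletePthPowers] at hm
  split_ifs at hm with hP
  · exact absurd rfl hm
  · rw [← HauserPerlega2024.support_chartTransform q _ hall]
    exact MvPolynomial.mem_support_iff.mpr hm

omit [DecidableEq K] in
/-- The OTHER off-degrees under the `u_j`-chart law: `off_k(λ_j m) + q = off_k(m) + off_j(m)` (`k ≠ j`, `|m| ≥ q`).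
[folklore] -/
theorem offDegree_chartExponent_of_ne (q : ℕ) {j k : Fin 3} (hk : k ≠ j) (m : Fin 3 →₀ ℕ) (hq : q ≤ m.degree) :
    ((chartExponent q j m).degree - chartExponent q j m k) + q = (m.degree - m k) + (m.degree - m j) := by
  rw [degree_chartExponent, chartExponent_apply, if_neg hk]
  have h1 := apply_le_degree_sub hk m
  have h2 : m j ≤ m.degree := by rw [degree_eq_add_sum_erase j m]; exact Nat.le_add_right _ _
  omega

/-- HEAVINESS TRANSPORT at a corner step: if the stage is axial for the played chart and for `u_k`, the next stage is
axial for `u_k`. [folklore] -/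
theorem Thread.offHeavy_succ (T : Thread q s₀) (t : ℕ) (hb : T.b (t + 1) = 0) {k : Fin 3}
    (hj : OffHeavy q (T.j (t + 1)) (T.st (t + 1)).F) (hk : OffHeavy q k (T.st (t + 1)).F) :
    OffHeavy q k (T.st (t + 1 + 1)).F := by
  classical
  intro m' hm'
  obtain ⟨m, hm, rfl⟩ := Finset.mem_image.mp (T.support_succ_subset_image t hb hm')
  have hq : q ≤ m.degree := T.le_degree_of_mem_support_succ t hm
  by_cases hkj : k = T.j (t + 1)
  · rw [hkj, offDegree_chartExponent]; exact hj m hm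
  · have := offDegree_chartExponent_of_ne q hkj m hq
    have h1 := hk m hm
    have h2 := hj m hm
    omega

end Calculus

section AxisLaw

variable {K : Type} [Field K] [DecidableEq K] {q : ℕ} {s₀ : State (Fin 3) K}

/-! ## §3 THE THREAD AXIS LAW (one chart) -/

/-- **THREAD AXIS LAW** (KERNEL, every `q`, every field): a thread that sits from time `t₀` on at the origin of ONE chart
`u_j` (`j_t = j`, `b_t = 0` for `t ≥ t₀ + 1`) is AXIAL for `u_j` at stage `t₀ + 1` — every monomial is off-`j`-heavy, so the
`u_j`-axis is a TOP LINE (`topIdeal_le_axis_of_offHeavy`).  Proof: a light monomial descends in degree forever.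
[DECIDED — PROVED here; = `LassoCut.no_axis_tail` minus its last line] (Sources: Hauser2010, §F.) -/
theorem Thread.offHeavy_of_axis_tail (T : Thread q s₀) (j : Fin 3) (t₀ : ℕ)
    (hrec : ∀ t, t₀ ≤ t → T.j (t + 1) = j ∧ T.b (t + 1) = 0) : OffHeavy q j (T.st (t₀ + 1)).F := by
  classical
  have descent : ∀ n : ℕ, ∀ t, t₀ ≤ t → ∀ m ∈ (T.st (t + 1)).F.support, m.degree - m j < q → n ≤ m.degree := by
    intro n
    induction n with
    | zero => intros; exact Nat.zero_le _
    | succ n ih =>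
      intro t ht m hm hlow
      obtain ⟨hj, hb⟩ := hrec t ht
      obtain ⟨hmem, hlow', hlt⟩ := T.low_monomial_transport hj hb hm hlow
      have := ih (t + 1) (by omega) _ hmem hlow'
      omega
  intro m hm
  by_contra hlow
  have := descent (m.degree + 1) t₀ le_rfl m hm (not_le.mp hlow)
  omega

/-- … hence axial for `u_j` at EVERY stage of the tail, the `u_j`-axis a top line and the top point NOT isolated there.
[DECIDED — PROVED here] (Sources: Hauser2010, §F.) -/
theorem Thread.axis_tail_axial (T : Thread q s₀) (j : Fin 3) (t₀ : ℕ)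
    (hrec : ∀ t, t₀ ≤ t → T.j (t + 1) = j ∧ T.b (t + 1) = 0) (t : ℕ) (ht : t₀ ≤ t) :
    OffHeavy q j (T.st (t + 1)).F ∧
      topIdeal q (T.st (t + 1)).F ≤ Ideal.span (MvPolynomial.X '' {i : Fin 3 | i ≠ j}) ∧
      ¬ IsolatedTop q (T.st (t + 1)).F := by
  have h := T.offHeavy_of_axis_tail j t fun t' ht' => hrec t' (le_trans ht ht')
  exact ⟨h, topIdeal_le_axis_of_offHeavy h, not_isolatedTop_of_offHeavy h⟩

/-- RECOVERY: the tree's forced-walk cell `LassoCut.no_axis_tail` is «thread axis law + isolation». [folklore] -/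
theorem _root_.Summit.ResolutionOfSingularities.ResolutionOfSingularities.Theorems.TightDefectClasses.ForcedWalk.no_axis_tail'
    (W : ForcedWalk q s₀) (j : Fin 3) (t₀ : ℕ) (hrec : ∀ t, t₀ ≤ t → W.j (t + 1) = j ∧ W.b (t + 1) = 0) : False :=
  not_isolatedTop_of_offHeavy (W.toThread.offHeavy_of_axis_tail j t₀ hrec) (W.isolated (t₀ + 1))

end AxisLaw

end Summit.ResolutionOfSingularities.ResolutionOfSingularities.Theorems.ThreadCut
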